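import Literature.Analysis.FluidPDE.FluidComputer.EnstrophyCurvature
import Literature.Analysis.FluidPDE.FluidComputer.ClassicalLatticeSpectra
import Literature.Analysis.FluidPDE.FluidComputer.Dealiasing
import HarnessLib

/-!
# The Kida–Pelz enstrophy curvature of the truncated system: `Z̈_S(0) = 2123/240 + (3993/2)ν² = (193/90 + 484ν²)·Z_S(0)`, exactly

PLACEMENT: a cell-own exact computation of `pub-fluidc` (topic `FluidComputer` under the host summit, per
the hub's 2026-08-19 rule: `Literature/` holds cited published statements only). No closed form for this
number is known in print (HOME/BENCHMARKS.md 'KP: Z″(0)/Z(0), Euler — EXACT 193/90', measured `2.1437 /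
2.1451 / 2.1446` by the cell's engines at 256³ f32 / 256³ f64 / 512³); the Taylor–Green analogue `5/48 + 18/R²`
IS printed [cite: TaylorGreen1937, eq. (47) p. 511] and typed in `Literature/…/TaylorGreenCurvature.lean`.
HONEST FRAMING (cell `pub-fluidc`, verbatim): *low prior, high value-of-information experiment on Tao's
machine paradigm; NOT a claim that NS blows up.* Nothing here concerns the Navier–Stokes PDE beyond the
Galerkin-truncated ODE system of `GalerkinEnergyBalance` / `EnstrophyCurvature` (exact arithmetic).

STATEMENT. `kp` = the Kida–Pelz datum of `ClassicalLatticeSpectra.KidaPelzHat` (24 modes, single shell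
`|k|² = 11`, `Z_S(0) = 33/8`). Along ANY unforced Galerkin solution `U` on a mode set `S` (any `ν`, any
pressure multiplier), supported in `S`, `U 0 = kp`, provided `S ⊇` the 24 modes and the even box
`E3 = {0,±2,±4,±6}³` (every wavevector the truncated advection term of `kp` can excite) — in particular on
every engine mask `Dealiasing.box K`, `K ≥ 6`: **`Z̈_S(0) = 3993/2·ν² + 2123/240`**
(`hasDerivAt_deriv_truncEnstrophy_kp`, `…_kp_box`), **`Z̈_S(0)/Z_S(0) = 484ν² + 193/90`** (`…_kp_ratio`),
truncated Euler **`Z̈_S(0) = 2123/240`, `Z̈/Z = 193/90 = 2.1444…`** (`…_kp_euler`, `…_kp_box_euler`);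
**`curvatureQ kp S 11 = 2123/240 = (193/90)·Z_S(kp)`** (`curvatureQ_kp`, `curvatureQ_kp_eq_ratio`).

HOW: the 24-mode datum excites 134 wavevectors (too many for `TaylorGreenCurvature`'s closed-form case
analysis); the value of `curvatureQ` = `Σ_{k∈S} (|k|²-11) Σ_j |P_k N_S[kp](k)_j|²` is transferred by generic
cast identities for SYMBOLIC wavevector entries to an INTEGER/RATIONAL MIRROR (`mT`, `advTerm`, `AT`,
`termMir`, `totalMir`: all KP coefficients are `i·m/8`, `m ∈ ℤ³`, so `N_S[kp](k) = i·A(k)/64`, `A(k) ∈ ℤ³`,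
`P_k(iA/64) = i/64·(A - (k·A)k/|k|²)`), and the mirror is EVALUATED BY THE KERNEL (`decide +kernel`,
343 outer wavevectors × 24 giving modes; the cell's exact Python `pub-fluidc-lit/tools/curvature_g15.py`
printed the same value). Bridges: `coeff_vec3`, `giving_term`, `advection_vec3`, `sum_normSq_leray_imag`
(any `k`, incl. `k = 0` under `x/0 = 0`), `curvTerm_vec3`; outer sum `advection_eq_zero_of_not_mem_E3`
(a giving pair of odd-entry modes forces `k ∈ E3`), `curvatureQ_eq_sum_E3`, `sum_evens`, `cast_sum7`.
No named facts (D-0026); 0 sorry; standard axioms. BENCHMARKS' row 'KP Z″(0)/Z(0) = 193/90 — still NOT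
typed' is retired: the engines' `2.1446 ± 0.001` now compares against a theorem of the ODE system they step.
-/

namespace Summit.NavierStokesRegularity.FluidComputer

open Complex ComplexConjugate Finset
open scoped BigOperators
open Literature.Analysis.FluidPDE.FluidComputer Literature.Analysis.FluidPDE.FluidComputer.ShellTransfer
  Literature.Analysis.FluidPDE.FluidComputer.ShellTransfer.KidaPelzHat

namespace KidaPelzCurvature

/-- `m(a,b,c)_j ∈ ℤ` with `kp.coeff (a,b,c) = i·m/8` (`coeff_vec3`); component index `j : ℕ`. -/
def mT (a b c : ℤ) (j : ℕ) : ℤ :=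
  if (a = 1 ∨ a = -1) ∧ (b = 3 ∨ b = -3) ∧ (c = 1 ∨ c = -1) then
    (if j = 0 then -a else if j = 1 then 0 else c)
  else if (a = 1 ∨ a = -1) ∧ (b = 1 ∨ b = -1) ∧ (c = 3 ∨ c = -3) then
    (if j = 0 then a else if j = 1 then -b else 0)
  else if (a = 3 ∨ a = -3) ∧ (b = 1 ∨ b = -1) ∧ (c = 1 ∨ c = -1) then
    (if j = 0 then 0 else if j = 1 then b else -c)
  else 0

/-- The two-point sum `f u + f (-u)` (mirror of `Σ_{a ∈ {u,-u}}`). -/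
def sum2 {α : Type} [Add α] (u : ℤ) (f : ℤ → α) : α := f u + f (-u)

/-- One giving-mode term at `k = (x,y,z)` from `p = (a,b,c)`: `(k · m(k-p)) · m(p)_j`
(`= -64 ×` the corresponding term of `N_S[kp]`, `giving_term`). -/
def advTerm (x y z a b c : ℤ) (j : ℕ) : ℤ :=
  (x * mT (x - a) (y - b) (z - c) 0 + y * mT (x - a) (y - b) (z - c) 1 + z * mT (x - a) (y - b) (z - c) 2)
    * mT a b c j

/-- `A(k)_j = Σ_{p ∈ modes} (k · m(k-p)) m(p)_j` over the three boxes `(±1,±3,±1)`, `(±1,±1,±3)`,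
`(±3,±1,±1)`; `N_S[kp](k)_j = i·A(k)_j/64` (`advection_vec3`). -/
def AT (x y z : ℤ) (j : ℕ) : ℤ :=
  sum2 1 (fun a => sum2 3 (fun b => sum2 1 (fun c => advTerm x y z a b c j)))
  + sum2 1 (fun a => sum2 1 (fun b => sum2 3 (fun c => advTerm x y z a b c j)))
  + sum2 3 (fun a => sum2 1 (fun b => sum2 1 (fun c => advTerm x y z a b c j)))

/-- The `k = (x,y,z)` term of `curvatureQ kp S 11` as a rational:
`(|k|² - 11) · Σ_j (A_j/64 - ((k·A/64)/|k|²) k_j)²` (`curvTerm_vec3`). -/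
def termMir (x y z : ℤ) : ℚ :=
  ((((x ^ 2 + y ^ 2 + z ^ 2 : ℤ) : ℚ)) - 11) *
    (((((AT x y z 0 : ℤ) : ℚ)) / 64 -
        ((x : ℚ) * (((AT x y z 0 : ℤ) : ℚ) / 64) + (y : ℚ) * (((AT x y z 1 : ℤ) : ℚ) / 64) +
            (z : ℚ) * (((AT x y z 2 : ℤ) : ℚ) / 64)) / (((x ^ 2 + y ^ 2 + z ^ 2 : ℤ) : ℚ)) * (x : ℚ)) ^ 2 +
      ((((AT x y z 1 : ℤ) : ℚ)) / 64 -
        ((x : ℚ) * (((AT x y z 0 : ℤ) : ℚ) / 64) + (y : ℚ) * (((AT x y z 1 : ℤ) : ℚ) / 64) +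
            (z : ℚ) * (((AT x y z 2 : ℤ) : ℚ) / 64)) / (((x ^ 2 + y ^ 2 + z ^ 2 : ℤ) : ℚ)) * (y : ℚ)) ^ 2 +
      ((((AT x y z 2 : ℤ) : ℚ)) / 64 -
        ((x : ℚ) * (((AT x y z 0 : ℤ) : ℚ) / 64) + (y : ℚ) * (((AT x y z 1 : ℤ) : ℚ) / 64) +
            (z : ℚ) * (((AT x y z 2 : ℤ) : ℚ) / 64)) / (((x ^ 2 + y ^ 2 + z ^ 2 : ℤ) : ℚ)) * (z : ℚ)) ^ 2)

/-- The seven-point sum over `{0, 2, -2, 4, -4, 6, -6}` (mirror of `Σ_{a ∈ evens}`, `sum_evens`). -/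
def sum7 {α : Type} [Add α] (f : ℤ → α) : α :=
  f 0 + (f 2 + (f (-2) + (f 4 + (f (-4) + (f 6 + f (-6))))))

/-- The mirror of `curvatureQ kp S 11`: `Σ_{k ∈ E3} termMir k`. -/
def totalMir : ℚ := sum7 fun x => sum7 fun y => sum7 fun z => termMir x y z

/-- **THE KERNEL EVALUATION**: `Σ_{k ∈ {0,±2,±4,±6}³} termMir k = 2123/240` (343 wavevectors × 24
giving modes, exact rational arithmetic, checked by the Lean kernel; the cell's independent exact Python
evaluation `pub-fluidc-lit/tools/curvature_g15.py` printed the same `193/90 · 33/8`). -/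
theorem totalMir_eq : totalMir = 2123 / 240 := by
  decide +kernel

/-- `![x,y,z] - ![a,b,c] = ![x-a, y-b, z-c]`. -/
theorem vec3_sub (x y z a b c : ℤ) : (![x, y, z] : Fin 3 → ℤ) - ![a, b, c] = ![x - a, y - b, z - c] := by
  funext i
  fin_cases i <;> rfl

/-- Membership of `![a,b,c]` in a product box is entrywise. -/
theorem vec3_mem_box {A B C : Finset ℤ} {a b c : ℤ} : (![a, b, c] : Fin 3 → ℤ) ∈ box A B C ↔
    a ∈ A ∧ b ∈ B ∧ c ∈ C := by
  rw [mem_box]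
  simp

/-- **The Kida–Pelz datum on `![a,b,c]` is `i·m(a,b,c)/8`** with the integer mirror `mT`. -/
theorem coeff_vec3 (a b c : ℤ) (j : Fin 3) :
    kp.coeff ![a, b, c] j = I * ((mT a b c j.val : ℤ) : ℂ) / 8 := by
  rw [kp_coeff]
  have e1 : ((![a, b, c] : Fin 3 → ℤ) ∈ M1) ↔ (a = 1 ∨ a = -1) ∧ (b = 3 ∨ b = -3) ∧ (c = 1 ∨ c = -1) := by
    rw [M1, vec3_mem_box, mem_pmOne, mem_pmThree, mem_pmOne]
  have e2 : ((![a, b, c] : Fin 3 → ℤ) ∈ M2) ↔ (a = 1 ∨ a = -1) ∧ (b = 1 ∨ b = -1) ∧ (c = 3 ∨ c = -3) := by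
    rw [M2, vec3_mem_box, mem_pmOne, mem_pmOne, mem_pmThree]
  have e3 : ((![a, b, c] : Fin 3 → ℤ) ∈ M3) ↔ (a = 3 ∨ a = -3) ∧ (b = 1 ∨ b = -1) ∧ (c = 1 ∨ c = -1) := by
    rw [M3, vec3_mem_box, mem_pmThree, mem_pmOne, mem_pmOne]
  unfold coeffFun mT
  by_cases h1 : (a = 1 ∨ a = -1) ∧ (b = 3 ∨ b = -3) ∧ (c = 1 ∨ c = -1)
  · rw [if_pos (e1.mpr h1), if_pos h1]
    fin_cases j <;> simp
  · rw [if_neg (fun h => h1 (e1.mp h)), if_neg h1]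
    by_cases h2 : (a = 1 ∨ a = -1) ∧ (b = 1 ∨ b = -1) ∧ (c = 3 ∨ c = -3)
    · rw [if_pos (e2.mpr h2), if_pos h2]
      fin_cases j <;> simp
    · rw [if_neg (fun h => h2 (e2.mp h)), if_neg h2]
      by_cases h3 : (a = 3 ∨ a = -3) ∧ (b = 1 ∨ b = -1) ∧ (c = 1 ∨ c = -1)
      · rw [if_pos (e3.mpr h3), if_pos h3]
        fin_cases j <;> simp
      · rw [if_neg (fun h => h3 (e3.mp h)), if_neg h3]
        simp

/-- `k · û_kp(![a,b,c]) = i·(x m₀ + y m₁ + z m₂)/8` for `k = ![x,y,z]`. -/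
theorem kdot_coeff_vec3 (x y z a b c : ℤ) :
    kdot ![x, y, z] (kp.coeff ![a, b, c]) =
      I * ((x * mT a b c 0 + y * mT a b c 1 + z * mT a b c 2 : ℤ) : ℂ) / 8 := by
  unfold kdot
  rw [Fin.sum_univ_three, coeff_vec3, coeff_vec3, coeff_vec3]
  simp only [Matrix.cons_val_zero, Matrix.cons_val_one, Matrix.head_cons, Matrix.cons_val_two,
    Matrix.tail_cons, Fin.val_zero, Fin.val_one, Fin.val_two]
  push_cast
  ring

/-- **One giving-mode term** of the truncated advection sum at `k = ![x,y,z]` from `p = ![a,b,c]`: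
`(k · û(k-p)) û(p)_j = -advTerm/64` (`i·i = -1`). -/
theorem giving_term (x y z a b c : ℤ) (j : Fin 3) :
    kdot ![x, y, z] (kp.coeff ((![x, y, z] : Fin 3 → ℤ) - ![a, b, c])) * kp.coeff ![a, b, c] j =
      -(((advTerm x y z a b c j.val : ℤ) : ℂ)) / 64 := by
  rw [vec3_sub, kdot_coeff_vec3, coeff_vec3]
  unfold advTerm
  push_cast
  linear_combination
    (((x : ℂ) * ((mT (x - a) (y - b) (z - c) 0 : ℤ) : ℂ) + (y : ℂ) * ((mT (x - a) (y - b) (z - c) 1 : ℤ) : ℂ) +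
        (z : ℂ) * ((mT (x - a) (y - b) (z - c) 2 : ℤ) : ℂ)) * ((mT a b c j.val : ℤ) : ℂ) / 64) * Complex.I_sq

/-- On any mode set containing the 24 modes the truncated advection term of `kp` is the 24-term sum over
the giving modes. -/
theorem advection_kp_eq {S : Finset (Fin 3 → ℤ)} (hS : modes ⊆ S) (k : Fin 3 → ℤ) (j : Fin 3) :
    advection kp S k j = -I * ∑ p ∈ modes, kdot k (kp.coeff (k - p)) * kp.coeff p j := by
  unfold advection
  congr 1
  rw [← Finset.sum_subset hS (fun p _ hp => by rw [kp_coeff p j, coeffFun_of_not_mem hp]; simp)]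

/-- **The truncated advection term of the Kida–Pelz datum at `![x,y,z]` is `i·AT/64`** with the
integer mirror `AT`. -/
theorem advection_vec3 {S : Finset (Fin 3 → ℤ)} (hS : modes ⊆ S) (x y z : ℤ) (j : Fin 3) :
    advection kp S ![x, y, z] j = I * ((AT x y z j.val : ℤ) : ℂ) / 64 := by
  rw [advection_kp_eq hS, sum_modes, M1, M2, M3, sum_box, sum_box, sum_box]
  simp only [sum_pmOne, sum_pmThree, giving_term]
  unfold AT sum2
  push_cast
  ring
/-- `|i r|² = r²`. -/
theorem normSq_I_mul_ofReal (r : ℝ) : Complex.normSq (I * (r : ℂ)) = r ^ 2 := by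
  rw [Complex.normSq_mul, Complex.normSq_I, one_mul, Complex.normSq_ofReal]
  ring

/-- **Leray projection of a purely imaginary vector**: for `v ∈ ℝ³`,
`Σ_j |P_k(i v)_j|² = Σ_j (v_j - ((k·v)/|k|²) k_j)²` (at `k = 0` both sides use `x/0 = 0`). -/
theorem sum_normSq_leray_imag (k : Fin 3 → ℤ) (v : Fin 3 → ℝ) :
    ∑ j, Complex.normSq (leray k (fun j => I * ((v j : ℝ) : ℂ)) j) =
      ∑ j, (v j - (∑ i, ((k i : ℤ) : ℝ) * v i) / knormSq k * ((k j : ℤ) : ℝ)) ^ 2 := by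
  refine Finset.sum_congr rfl fun j _ => ?_
  have e : leray k (fun j => I * ((v j : ℝ) : ℂ)) j =
      I * (((v j - (∑ i, ((k i : ℤ) : ℝ) * v i) / knormSq k * ((k j : ℤ) : ℝ) : ℝ)) : ℂ) := by
    rw [leray_apply]
    unfold kdot
    rw [Fin.sum_univ_three, Fin.sum_univ_three]
    push_cast
    ring
  rw [e, normSq_I_mul_ofReal]
/-- `|![x,y,z]|² = x² + y² + z²`. -/
theorem knormSq_vec3 (x y z : ℤ) : knormSq ![x, y, z] = ((x ^ 2 + y ^ 2 + z ^ 2 : ℤ) : ℝ) := by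
  unfold knormSq
  rw [Fin.sum_univ_three]
  simp only [Matrix.cons_val_zero, Matrix.cons_val_one, Matrix.head_cons, Matrix.cons_val_two,
    Matrix.tail_cons]
  push_cast
  ring

/-- **The `k = ![x,y,z]` term of `curvatureQ kp S 11` is the rational `termMir x y z`.** -/
theorem curvTerm_vec3 {S : Finset (Fin 3 → ℤ)} (hS : modes ⊆ S) (x y z : ℤ) :
    (knormSq ![x, y, z] - 11) * ∑ j, Complex.normSq (leray ![x, y, z] (advection kp S ![x, y, z]) j) =
      ((termMir x y z : ℚ) : ℝ) := by
  have hadv : advection kp S ![x, y, z] =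
      fun j => I * (((fun j : Fin 3 => ((AT x y z j.val : ℤ) : ℝ) / 64) j : ℝ) : ℂ) := by
    funext j
    rw [advection_vec3 hS]
    push_cast
    ring
  rw [hadv, sum_normSq_leray_imag, knormSq_vec3, Fin.sum_univ_three, Fin.sum_univ_three]
  simp only [Matrix.cons_val_zero, Matrix.cons_val_one, Matrix.head_cons, Matrix.cons_val_two,
    Matrix.tail_cons, Fin.val_zero, Fin.val_one, Fin.val_two]
  unfold termMir
  push_cast
  ring

/-- `{0, 2, -2, 4, -4, 6, -6}`. -/
def evens : Finset ℤ := {0, 2, -2, 4, -4, 6, -6}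

/-- Membership in `evens`. -/
theorem mem_evens {a : ℤ} : a ∈ evens ↔ a = 0 ∨ a = 2 ∨ a = -2 ∨ a = 4 ∨ a = -4 ∨ a = 6 ∨ a = -6 := by
  unfold evens
  simp only [Finset.mem_insert, Finset.mem_singleton]

/-- `Σ_{a ∈ evens} f a = sum7 f`. -/
theorem sum_evens {M : Type} [AddCommMonoid M] (f : ℤ → M) : ∑ a ∈ evens, f a = sum7 f := by
  unfold evens sum7
  rw [Finset.sum_insert (by decide), Finset.sum_insert (by decide), Finset.sum_insert (by decide),
    Finset.sum_insert (by decide), Finset.sum_insert (by decide), Finset.sum_insert (by decide),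
    Finset.sum_singleton]

/-- **The excited box** `E3 = {0,±2,±4,±6}³`. -/
def E3 : Finset (Fin 3 → ℤ) := box evens evens evens

/-- Entries of the 24 modes are `±1` or `±3`. -/
theorem entry_of_mem_modes {q : Fin 3 → ℤ} (hq : q ∈ modes) (i : Fin 3) :
    q i = 1 ∨ q i = -1 ∨ q i = 3 ∨ q i = -3 := by
  unfold modes at hq
  rcases Finset.mem_union.mp hq with h12 | h3
  · rcases Finset.mem_union.mp h12 with h1 | h2
    · rw [M1, mem_box, mem_pmOne, mem_pmThree, mem_pmOne] at h1
      fin_cases i <;> simp <;> tauto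
    · rw [M2, mem_box, mem_pmOne, mem_pmOne, mem_pmThree] at h2
      fin_cases i <;> simp <;> tauto
  · rw [M3, mem_box, mem_pmThree, mem_pmOne, mem_pmOne] at h3
    fin_cases i <;> simp <;> tauto

/-- A pair of modes `(p, k - p)` can only reach `k ∈ E3`. -/
theorem mem_E3_of_sub_mem {k p : Fin 3 → ℤ} (hp : p ∈ modes) (hq : k - p ∈ modes) : k ∈ E3 := by
  unfold E3
  rw [mem_box, mem_evens, mem_evens, mem_evens]
  have h : ∀ i, k i = 0 ∨ k i = 2 ∨ k i = -2 ∨ k i = 4 ∨ k i = -4 ∨ k i = 6 ∨ k i = -6 := by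
    intro i
    have h1 := entry_of_mem_modes hp i
    have h2 := entry_of_mem_modes hq i
    rw [Pi.sub_apply] at h2
    omega
  exact ⟨h 0, h 1, h 2⟩

/-- **Off `E3` the truncated advection term of `kp` vanishes** (every giving leg `û(k-p)` is zero). -/
theorem advection_eq_zero_of_not_mem_E3 {S : Finset (Fin 3 → ℤ)} (hS : modes ⊆ S) {k : Fin 3 → ℤ}
    (hk : k ∉ E3) : advection kp S k = 0 := by
  funext j
  rw [advection_kp_eq hS]
  have h0 : ∑ p ∈ modes, kdot k (kp.coeff (k - p)) * kp.coeff p j = 0 := by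
    refine Finset.sum_eq_zero fun p hp => ?_
    have hq : k - p ∉ modes := fun hq => hk (mem_E3_of_sub_mem hp hq)
    have hc : kp.coeff (k - p) = 0 := by
      funext i
      rw [kp_coeff, coeffFun_of_not_mem hq]
      rfl
    rw [hc]
    unfold kdot
    simp
  rw [h0]
  simp

/-- `curvatureQ kp S 11` is its restriction to the excited box (for `E3 ⊆ S`). -/
theorem curvatureQ_eq_sum_E3 {S : Finset (Fin 3 → ℤ)} (hS : modes ⊆ S) (hE : E3 ⊆ S) :
    curvatureQ kp S 11 =
      ∑ k ∈ E3, (knormSq k - 11) * ∑ j, Complex.normSq (leray k (advection kp S k) j) := by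
  unfold curvatureQ
  symm
  refine Finset.sum_subset hE fun k _ hk => ?_
  rw [advection_eq_zero_of_not_mem_E3 hS hk, leray_zero]
  simp
/-- Casting the seven-point sum. -/
theorem cast_sum7 (f : ℤ → ℚ) : ((sum7 f : ℚ) : ℝ) = sum7 fun x => ((f x : ℚ) : ℝ) := by
  unfold sum7
  push_cast
  rfl

/-- **`curvatureQ kp S 11` equals the rational mirror** for every mode set containing the 24 modes and
the excited box. -/
theorem curvatureQ_kp_eq_totalMir {S : Finset (Fin 3 → ℤ)} (hS : modes ⊆ S) (hE : E3 ⊆ S) :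
    curvatureQ kp S 11 = ((totalMir : ℚ) : ℝ) := by
  rw [curvatureQ_eq_sum_E3 hS hE, E3, sum_box]
  rw [Finset.sum_congr rfl fun x _ => Finset.sum_congr rfl fun y _ =>
    Finset.sum_congr rfl fun z _ => curvTerm_vec3 hS x y z]
  simp only [sum_evens, totalMir, cast_sum7]

/-- **`Q_S(kp) = Σ_{k∈S}(|k|²-11)|P_k N_S[kp](k)|² = 2123/240`** on every mode set containing the 24
Kida–Pelz modes and the excited box `{0,±2,±4,±6}³`. -/
theorem curvatureQ_kp {S : Finset (Fin 3 → ℤ)} (hS : modes ⊆ S) (hE : E3 ⊆ S) :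
    curvatureQ kp S 11 = 2123 / 240 := by
  rw [curvatureQ_kp_eq_totalMir hS hE, totalMir_eq]
  push_cast
  ring

/-- The same as a ratio to the datum's enstrophy `Z_S(kp) = 33/8`: **`Q_S(kp) = (193/90)·Z_S(kp)`**. -/
theorem curvatureQ_kp_eq_ratio {S : Finset (Fin 3 → ℤ)} (hS : modes ⊆ S) (hE : E3 ⊆ S) :
    curvatureQ kp S 11 = 193 / 90 * truncEnstrophy kp S := by
  rw [curvatureQ_kp hS hE, truncEnstrophy_kp_of_subset hS]
  norm_num

/-- **THE KIDA–PELZ ENSTROPHY CURVATURE.** Along any unforced Galerkin solution supported in a mode set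
containing the 24 modes and the excited box, started from the Kida–Pelz datum (any viscosity `ν`, any
pressure multiplier), `Z̈_S(0) = 4ν²·11²·Z_S(0) + Q_S(kp) = (3993/2)ν² + 2123/240`. -/
theorem hasDerivAt_deriv_truncEnstrophy_kp {U : ℝ → FourierVelocity} {S : Finset (Fin 3 → ℤ)} {ν : ℝ}
    {c : ℝ → (Fin 3 → ℤ) → ℂ} (hU : IsGalerkinSolution U S ν c fun _ _ _ => 0)
    (hsupp : IsSupportedOn U S) (h0 : U 0 = kp) (hS : modes ⊆ S) (hE : E3 ⊆ S) :
    HasDerivAt (deriv fun s => truncEnstrophy (U s) S) (3993 / 2 * ν ^ 2 + 2123 / 240) 0 := by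
  have h := hasDerivAt_deriv_truncEnstrophy_singleShell' hU hsupp 0 (lam := 11)
    (by rw [h0]; exact kp_isSingleShell)
  rw [h0, truncEnstrophy_kp_of_subset hS, curvatureQ_kp hS hE] at h
  convert h using 1
  ring

/-- The ratio form: **`Z̈_S(0) = (484ν² + 193/90)·Z_S(0)`**, `Z_S(0) = 33/8`. -/
theorem hasDerivAt_deriv_truncEnstrophy_kp_ratio {U : ℝ → FourierVelocity} {S : Finset (Fin 3 → ℤ)}
    {ν : ℝ} {c : ℝ → (Fin 3 → ℤ) → ℂ} (hU : IsGalerkinSolution U S ν c fun _ _ _ => 0)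
    (hsupp : IsSupportedOn U S) (h0 : U 0 = kp) (hS : modes ⊆ S) (hE : E3 ⊆ S) :
    HasDerivAt (deriv fun s => truncEnstrophy (U s) S)
      ((484 * ν ^ 2 + 193 / 90) * truncEnstrophy (U 0) S) 0 := by
  have h := hasDerivAt_deriv_truncEnstrophy_kp hU hsupp h0 hS hE
  rw [h0, truncEnstrophy_kp_of_subset hS]
  convert h using 1
  ring

/-- Truncated EULER: the Kida–Pelz enstrophy starts as the even parabola
`Z_S(t) = 33/8 + (2123/480)t² + o(t²)`, **`Z̈_S(0) = 2123/240`, `Z̈_S(0)/Z_S(0) = 193/90 = 2.1444…`**. -/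
theorem hasDerivAt_deriv_truncEnstrophy_kp_euler {U : ℝ → FourierVelocity} {S : Finset (Fin 3 → ℤ)}
    {c : ℝ → (Fin 3 → ℤ) → ℂ} (hU : IsGalerkinSolution U S 0 c fun _ _ _ => 0)
    (hsupp : IsSupportedOn U S) (h0 : U 0 = kp) (hS : modes ⊆ S) (hE : E3 ⊆ S) :
    HasDerivAt (deriv fun s => truncEnstrophy (U s) S) (2123 / 240) 0 := by
  have h := hasDerivAt_deriv_truncEnstrophy_kp hU hsupp h0 hS hE
  norm_num at h
  exact h

/-- The 24 modes lie in every cubic mask `box K`, `K ≥ 3`. -/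
theorem modes_subset_dealiasingBox {K : ℕ} (hK : 3 ≤ K) : modes ⊆ Dealiasing.box K := by
  intro q hq
  rw [Dealiasing.mem_box]
  intro i
  have hK' : (3 : ℤ) ≤ (K : ℤ) := by exact_mod_cast hK
  rcases entry_of_mem_modes hq i with h | h | h | h <;> rw [h] <;> simp <;> omega

/-- The excited box lies in every cubic mask `box K`, `K ≥ 6`. -/
theorem E3_subset_dealiasingBox {K : ℕ} (hK : 6 ≤ K) : E3 ⊆ Dealiasing.box K := by
  intro q hq
  unfold E3 at hq
  rw [mem_box, mem_evens, mem_evens, mem_evens] at hq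
  rw [Dealiasing.mem_box]
  have hK' : (6 : ℤ) ≤ (K : ℤ) := by exact_mod_cast hK
  intro i
  fin_cases i
  · rcases hq.1 with h | h | h | h | h | h | h <;> simp [h] <;> omega
  · rcases hq.2.1 with h | h | h | h | h | h | h <;> simp [h] <;> omega
  · rcases hq.2.2 with h | h | h | h | h | h | h <;> simp [h] <;> omega

/-- **On the engines' masks**: along any unforced Galerkin solution supported in `Dealiasing.box K`,
`K ≥ 6` (both engines of the cell at every production resolution), started from the Kida–Pelz datum,
`Z̈(0) = (3993/2)ν² + 2123/240 = (484ν² + 193/90)·Z(0)`. -/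
theorem hasDerivAt_deriv_truncEnstrophy_kp_box {U : ℝ → FourierVelocity} {K : ℕ} (hK : 6 ≤ K) {ν : ℝ}
    {c : ℝ → (Fin 3 → ℤ) → ℂ} (hU : IsGalerkinSolution U (Dealiasing.box K) ν c fun _ _ _ => 0)
    (hsupp : IsSupportedOn U (Dealiasing.box K)) (h0 : U 0 = kp) :
    HasDerivAt (deriv fun s => truncEnstrophy (U s) (Dealiasing.box K)) (3993 / 2 * ν ^ 2 + 2123 / 240) 0 :=
  hasDerivAt_deriv_truncEnstrophy_kp hU hsupp h0 (modes_subset_dealiasingBox (by omega))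
    (E3_subset_dealiasingBox hK)

/-- Truncated Euler on the engines' masks: `Z̈(0) = 2123/240`, i.e. `Z̈(0)/Z(0) = 193/90`. -/
theorem hasDerivAt_deriv_truncEnstrophy_kp_box_euler {U : ℝ → FourierVelocity} {K : ℕ} (hK : 6 ≤ K)
    {c : ℝ → (Fin 3 → ℤ) → ℂ} (hU : IsGalerkinSolution U (Dealiasing.box K) 0 c fun _ _ _ => 0)
    (hsupp : IsSupportedOn U (Dealiasing.box K)) (h0 : U 0 = kp) :
    HasDerivAt (deriv fun s => truncEnstrophy (U s) (Dealiasing.box K)) (2123 / 240) 0 :=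
  hasDerivAt_deriv_truncEnstrophy_kp_euler hU hsupp h0 (modes_subset_dealiasingBox (by omega))
    (E3_subset_dealiasingBox hK)

end KidaPelzCurvature

end Summit.NavierStokesRegularity.FluidComputer
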